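import Summits.ResolutionOfSingularities.ResolutionOfSingularities.Theorems.FrobeniusLadderFInjectiveMacaulayficationX2CubicFormFloorCert
import Summits.ResolutionOfSingularities.ResolutionOfSingularities.Theorems.FrobeniusLadderFInjectiveMacaulayficationX2CubicFormScope
import Summits.ResolutionOfSingularities.ResolutionOfSingularities.Theorems.FrobeniusLadderFInjectiveMacaulayficationX2Cubic4FloorFull
import HarnessLib

/-!
# ★ THE T-SIDE CLASS ROW, COMPLETE: `tStep_row_of_doublePoint_cubicForm` — scope ∧ LEGAL-AND-FULL point floor ∧ `TStepInstanceAt`, for EVERY double point `x² + F₃` over a prime,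
# smooth cubic, every prime `p`, every field (the class analogue of ✓p679851 `tStep_row_x2cubic4`; FULLness of the floor discharged CLASS-WIDE by the pointwise Fedder argument
# ✓ `X2CubicFormFloorCert`)
# (crux `FInjectiveMacaulayfication` stmt-ResolutionOfSingularities-15315, chain w45a; res-L1-w45a-plan-1 ANSWER 00:15Z named target; seat res-L1-w45a-lead-1 g11)

[OURS · L1 W4.5a] Support file (`--supports stmt-ResolutionOfSingularities-15315 --as helper`); def-free; UNCONDITIONAL; no named fact; NOT a statement of any manuscript. CLASS-LEVEL
instance theorem WITH its non-vacuity: evidence for nothing beyond the class it names (transversal-A₁ cubic-surface double points); a one-step tool; it does not move T″'s generality;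
T″ and the F-half stay OPEN; nothing of the crux is proved. Vertex FULLness (the T″ stub's outer hypothesis «y FULL») is NOT included — per bed (Fermat ✓p678024). AI-written (AI review is
weaker than expert review).

* §1 plumbing: `pderiv_rename_eq_zero` (a variable outside the range of the embedding), `pderiv_rename_of_injective` (`∂_{e j}(rename e q) = rename e (∂_j q)`),
  `exists_pderiv_not_mem` (a derivation non-vanishing at a prime ⇒ some partial non-vanishing), `smooth_rename` (pointwise smoothness transports along `rename e`).
* §2 ★★ `clause_every_chart` (hpts for the five charts of `x² + F`: singular charts by `X2CubicFormFloorCert.clause_chart_smooth`, `x`-chart vacuous), ★★ `affineBlowup_fullCl`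
  (`Bl_𝔪 Y` FULL at every point), `pointFloor_full` (every blowing up of the germ along the point floor is FULL at every stalk).
* §3 ★★★ `tStep_row_of_doublePoint_cubicForm`.
[folklore assembly; cite: Fedder1983, Thm. 1.12; GortzWedhorn2020, Prop. 13.91 (2), (13.19); StacksProject, Tag 0804; Temkin2008, §2.1]
-/

-- single-problem summit: the doubled namespace component is forced
set_option linter.dupNamespace false

noncomputable section

namespace Summit.ResolutionOfSingularities.ResolutionOfSingularities.Theorems.FInjectiveMacaulayfication.X2CubicFormTStepRow

open CategoryTheory CategoryTheory.Limits AlgebraicGeometry TopologicalSpace IsLocalRing MvPolynomial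
open Literature.AlgebraicGeometry.Resolution
open Summit.ResolutionOfSingularities.ResolutionOfSingularities.Theorems.FInjectiveMacaulayfication
open SliceableCentre GermOfGlobalBlowup

variable (k : Type) [Field k]

/-! ## §1 Plumbing: partials and `rename` -/

/-- `∂_i (rename e q) = 0` when `i` is not in the range of `e`. [elementary] -/
theorem pderiv_rename_eq_zero {m n : ℕ} (e : Fin m → Fin n) (i : Fin n) (hi : ∀ j, e j ≠ i) (q : MvPolynomial (Fin m) k) :
    pderiv i (rename e q) = 0 := by
  induction q using MvPolynomial.induction_on with
  | C c => rw [rename_C, pderiv_C]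
  | add p q hp hq => rw [map_add, map_add, hp, hq, add_zero]
  | mul_X p j hp => rw [map_mul, rename_X, Derivation.leibniz, hp, smul_zero, add_zero, pderiv_X_of_ne (hi j), smul_zero]

/-- `∂_{e j} (rename e q) = rename e (∂_j q)` for an injective `e`. [elementary] -/
theorem pderiv_rename_of_injective {m n : ℕ} (e : Fin m → Fin n) (he : Function.Injective e) (j : Fin m) (q : MvPolynomial (Fin m) k) :
    pderiv (e j) (rename e q) = rename e (pderiv j q) := by
  induction q using MvPolynomial.induction_on with
  | C c => rw [rename_C, pderiv_C, pderiv_C, map_zero]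
  | add p q hp hq => rw [map_add, map_add, hp, hq, map_add, map_add]
  | mul_X p i hp =>
      rw [map_mul, rename_X, Derivation.leibniz, Derivation.leibniz, hp, map_add, smul_eq_mul, smul_eq_mul, smul_eq_mul, smul_eq_mul, map_mul, map_mul, rename_X]
      by_cases hij : i = j
      · subst hij; rw [pderiv_X_self, pderiv_X_self, map_one]
      · rw [pderiv_X_of_ne hij, pderiv_X_of_ne (fun h => hij (he h)), map_zero]

/-- **A derivation non-vanishing at a prime forces some partial to be non-vanishing there** (`D = Σ_j D(X_j)·∂_j` on a polynomial ring). [elementary] -/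
theorem exists_pderiv_not_mem {m : ℕ} (q : MvPolynomial (Fin m) k) (𝔮 : Ideal (MvPolynomial (Fin m) k))
    (D : Derivation k (MvPolynomial (Fin m) k) (MvPolynomial (Fin m) k)) (hD : D q ∉ 𝔮) : ∃ j : Fin m, pderiv j q ∉ 𝔮 := by
  classical
  by_contra hall
  push Not at hall
  apply hD
  -- `(Σ_{j ∈ s} c_j • ∂_j) r = Σ_{j ∈ s} c_j · ∂_j r`
  have happly : ∀ (s : Finset (Fin m)) (r : MvPolynomial (Fin m) k),
      (∑ j ∈ s, (D (X j)) • (pderiv j : Derivation k (MvPolynomial (Fin m) k) (MvPolynomial (Fin m) k))) r = ∑ j ∈ s, D (X j) * pderiv j r := by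
    intro s r
    induction s using Finset.induction_on with
    | empty => simp
    | insert j s hj ih => rw [Finset.sum_insert hj, Finset.sum_insert hj, Derivation.add_apply, Derivation.smul_apply, ih, smul_eq_mul]
  have hsum : D = ∑ j : Fin m, (D (X j)) • (pderiv j : Derivation k (MvPolynomial (Fin m) k) (MvPolynomial (Fin m) k)) := by
    refine MvPolynomial.derivation_ext fun i => ?_
    rw [happly, Finset.sum_eq_single i]
    · rw [pderiv_X_self, mul_one]
    · intro j _ hji; rw [pderiv_X_of_ne (Ne.symm hji), mul_zero]
    · intro h; exact absurd (Finset.mem_univ i) h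
  rw [hsum, happly]
  exact 𝔮.sum_mem fun j _ => 𝔮.mul_mem_left _ (hall j)

/-- **Pointwise smoothness transports along `rename e`** (`e` injective): if every prime of `k[Y]` containing `w` misses some `D w`, then every prime of `k[X]` containing
`rename e w` misses some `∂_b (rename e w)`. [elementary] -/
theorem smooth_rename {m n : ℕ} (e : Fin m → Fin n) (he : Function.Injective e) (w : MvPolynomial (Fin m) k)
    (hws : ∀ 𝔮 : Ideal (MvPolynomial (Fin m) k), 𝔮.IsPrime → w ∈ 𝔮 → ∃ D : Derivation k (MvPolynomial (Fin m) k) (MvPolynomial (Fin m) k), D w ∉ 𝔮) :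
    ∀ 𝔮 : Ideal (MvPolynomial (Fin n) k), 𝔮.IsPrime → rename e w ∈ 𝔮 → ∃ b : Fin n, pderiv b (rename e w) ∉ 𝔮 := by
  intro 𝔮 h𝔮 hw
  haveI := h𝔮
  obtain ⟨D, hD⟩ := hws (𝔮.comap (rename e : MvPolynomial (Fin m) k →ₐ[k] MvPolynomial (Fin n) k).toRingHom) (Ideal.comap_isPrime _ _)
    (by rw [Ideal.mem_comap]; exact hw)
  obtain ⟨j, hj⟩ := exists_pderiv_not_mem k w _ D hD
  refine ⟨e j, ?_⟩
  rw [pderiv_rename_of_injective k e he j w]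
  intro h
  exact hj (by rw [Ideal.mem_comap]; exact h)

/-- `X₄² + X_a·W ≠ 0` for `a ≠ 4` (evaluate at `e₄`). [elementary] -/
theorem G_ne_zero (a : Fin 5) (ha : a ≠ 4) (W G : MvPolynomial (Fin 5) k) (hG : G = X 4 ^ 2 + X a * W) : G ≠ 0 := by
  intro h0
  have := congrArg (MvPolynomial.eval (Pi.single 4 1 : Fin 5 → k)) h0
  rw [hG] at this
  simp [ha] at this

/-! ## §2 The point floor of `x² + F₃` is FULL at every stalk, class level -/

/-- ★★ **`hpts` for the five charts of `Bl_𝔪 Y`, `Y = {x² + F}`, class level**: the FULL clause at every maximal ideal `Q ∋ x̄ᵢ` of each chart ring — the four singular charts by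
`X2CubicFormFloorCert.clause_chart_smooth` (pointwise Fedder), the `x`-chart vacuously. [OURS · assembly] -/
theorem clause_every_chart (p : ℕ) [Fact p.Prime] [CharP k p] (G : Fin 5 → MvPolynomial (Fin 5) k) (w : Fin 4 → MvPolynomial (Fin 3) k)
    (hGw : ∀ a : Fin 4, G (Fin.castSucc a) = X 4 ^ 2 + X (Fin.castSucc a) * rename ((![![1, 2, 3], ![0, 2, 3], ![0, 1, 3], ![0, 1, 2]] : Fin 4 → Fin 3 → Fin 5) a) (w a))
    (hws : ∀ (a : Fin 4) (Q : Ideal (MvPolynomial (Fin 3) k)), Q.IsPrime → w a ∈ Q → ∃ D : Derivation k (MvPolynomial (Fin 3) k) (MvPolynomial (Fin 3) k), D (w a) ∉ Q)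
    (q : MvPolynomial (Fin 5) k) (hG4 : G 4 = 1 + X 4 * q) :
    ∀ (i : Fin 5) (Q : Ideal (MvPolynomial (Fin 5) k ⧸ Ideal.span {G i})) [Q.IsMaximal],
      Ideal.Quotient.mk _ (X i) ∈ Q →
      ∀ d : ℕ, ringKrullDim (Localization.AtPrime Q) = d → ∀ s : Fin d → Localization.AtPrime Q,
        (Ideal.span (Set.range s)).radical.IsMaximal →
          RingTheory.Sequence.IsWeaklyRegular (Localization.AtPrime Q) (List.ofFn s) ∧
          ∀ y : Localization.AtPrime Q, (∃ e : ℕ, y ^ p ^ e ∈ Ideal.span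
            ((fun z : Localization.AtPrime Q => z ^ p ^ e) ''
              (Ideal.span (Set.range s) : Set (Localization.AtPrime Q)))) → y ∈ Ideal.span (Set.range s) := by
  -- the singular charts, uniformly in `a : Fin 4`
  have hsing : ∀ (a : Fin 4) (Q : Ideal (MvPolynomial (Fin 5) k ⧸ Ideal.span {G (Fin.castSucc a)})) [Q.IsMaximal],
      ∀ d : ℕ, ringKrullDim (Localization.AtPrime Q) = d → ∀ s : Fin d → Localization.AtPrime Q,
        (Ideal.span (Set.range s)).radical.IsMaximal →
          RingTheory.Sequence.IsWeaklyRegular (Localization.AtPrime Q) (List.ofFn s) ∧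
          ∀ y : Localization.AtPrime Q, (∃ e : ℕ, y ^ p ^ e ∈ Ideal.span
            ((fun z : Localization.AtPrime Q => z ^ p ^ e) ''
              (Ideal.span (Set.range s) : Set (Localization.AtPrime Q)))) → y ∈ Ideal.span (Set.range s) := by
    intro a Q hQ
    have ha4 : Fin.castSucc a ≠ (4 : Fin 5) := (Fin.castSucc_lt_last a).ne
    have he_inj : Function.Injective ((![![1, 2, 3], ![0, 2, 3], ![0, 1, 3], ![0, 1, 2]] : Fin 4 → Fin 3 → Fin 5) a) := by
      fin_cases a <;> decide
    have he_a : ∀ j, ((![![1, 2, 3], ![0, 2, 3], ![0, 1, 3], ![0, 1, 2]] : Fin 4 → Fin 3 → Fin 5) a) j ≠ Fin.castSucc a := by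
      fin_cases a <;> decide
    have he_4 : ∀ j, ((![![1, 2, 3], ![0, 2, 3], ![0, 1, 3], ![0, 1, 2]] : Fin 4 → Fin 3 → Fin 5) a) j ≠ 4 := by
      fin_cases a <;> decide
    exact X2CubicFormFloorCert.clause_chart_smooth p k (Fin.castSucc a) ha4 _ _ (hGw a) (pderiv_rename_eq_zero k _ _ (he_a) (w a))
      (pderiv_rename_eq_zero k _ _ (he_4) (w a)) (G_ne_zero k _ ha4 _ _ (hGw a)) (smooth_rename k _ he_inj (w a) (hws a)) Q
  intro i Q hQ hXi
  by_cases hi : i = 4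
  · subst hi
    exact absurd hXi (X2Cubic4FloorFullCert.chartFour_X_not_mem k (G 4) q hG4 Q (Ideal.IsMaximal.ne_top hQ))
  · have : i = Fin.castSucc (i.castPred hi) := (Fin.castSucc_castPred i hi).symm
    revert Q
    rw [this]
    intro Q hQ _
    exact hsing (i.castPred hi) Q

/-- ★★ **`Bl_𝔪 Y` IS FULL AT EVERY POINT, CLASS LEVEL** (`Y = {X₄² + F}`, `F` a cubic form; `f` prime; `Y` regular off `v`; dehomogenisations with smooth zero locus; every prime `p`).
[OURS · assembly via `GermOfGlobalBlowup.hypersurfacePointBlowup_fullCl`] -/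
theorem affineBlowup_fullCl (p : ℕ) [Fact p.Prime] [CharP k p] (F : MvPolynomial (Fin 4) k) (hF : F.IsHomogeneous 3) (f : MvPolynomial (Fin 5) k)
    (hf : f = X 4 ^ 2 + rename (Fin.castSucc : Fin 4 → Fin 5) F) (hprime : Prime f)
    (hoff : ∀ (P : Ideal (MvPolynomial (Fin 5) k ⧸ Ideal.span {f})) [P.IsPrime],
      ¬ Ideal.span (Set.range fun j : Fin 5 => Ideal.Quotient.mk (Ideal.span {f}) (X j)) ≤ P → IsRegularLocalRing (Localization.AtPrime P))
    (hw : ∀ a : Fin 4, Prime (MvPolynomial.aeval ((![![1, X 0, X 1, X 2], ![X 0, 1, X 1, X 2], ![X 0, X 1, 1, X 2], ![X 0, X 1, X 2, 1]] :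
      Fin 4 → Fin 4 → MvPolynomial (Fin 3) k) a) F))
    (hws : ∀ (a : Fin 4) (Q : Ideal (MvPolynomial (Fin 3) k)), Q.IsPrime →
      MvPolynomial.aeval ((![![1, X 0, X 1, X 2], ![X 0, 1, X 1, X 2], ![X 0, X 1, 1, X 2], ![X 0, X 1, X 2, 1]] : Fin 4 → Fin 4 → MvPolynomial (Fin 3) k) a) F ∈ Q →
      ∃ D : Derivation k (MvPolynomial (Fin 3) k) (MvPolynomial (Fin 3) k),
        D (MvPolynomial.aeval ((![![1, X 0, X 1, X 2], ![X 0, 1, X 1, X 2], ![X 0, X 1, 1, X 2], ![X 0, X 1, X 2, 1]] : Fin 4 → Fin 4 → MvPolynomial (Fin 3) k) a) F) ∉ Q) :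
    ∀ y : ↥(affineBlowup (Ideal.span (Set.range fun j : Fin 5 => Ideal.Quotient.mk (Ideal.span {f}) (X j)))),
      FullCl p ((affineBlowup (Ideal.span (Set.range fun j : Fin 5 => Ideal.Quotient.mk (Ideal.span {f}) (X j)))).presheaf.stalk y) := by
  haveI hfprime : (Ideal.span {f}).IsPrime := (Ideal.span_singleton_prime hprime.ne_zero).mpr hprime
  have hF0 : F ≠ 0 := by
    intro h0; have := (hw 0).ne_zero; rw [h0, map_zero] at this; exact this rfl
  obtain ⟨G, hG⟩ : ∃ G : Fin 5 → MvPolynomial (Fin 5) k, G = fun i : Fin 5 =>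
      if h : i = 4 then 1 + X 4 * rename (Fin.castSucc : Fin 4 → Fin 5) F
      else X 4 ^ 2 + X i * rename ((![![1, 2, 3], ![0, 2, 3], ![0, 1, 3], ![0, 1, 2]] : Fin 4 → Fin 3 → Fin 5) (i.castPred h))
        (MvPolynomial.aeval ((![![1, X 0, X 1, X 2], ![X 0, 1, X 1, X 2], ![X 0, X 1, 1, X 2], ![X 0, X 1, X 2, 1]] :
          Fin 4 → Fin 4 → MvPolynomial (Fin 3) k) (i.castPred h)) F) := ⟨_, rfl⟩
  have hG4 : G 4 = 1 + X 4 * rename (Fin.castSucc : Fin 4 → Fin 5) F := by rw [hG]; simp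
  have hGw : ∀ a : Fin 4, G (Fin.castSucc a) = X 4 ^ 2 + X (Fin.castSucc a) *
      rename ((![![1, 2, 3], ![0, 2, 3], ![0, 1, 3], ![0, 1, 2]] : Fin 4 → Fin 3 → Fin 5) a)
        (MvPolynomial.aeval ((![![1, X 0, X 1, X 2], ![X 0, 1, X 1, X 2], ![X 0, X 1, 1, X 2], ![X 0, X 1, X 2, 1]] :
          Fin 4 → Fin 4 → MvPolynomial (Fin 3) k) a) F) := by
    intro a
    have ha4 : Fin.castSucc a ≠ (4 : Fin 5) := (Fin.castSucc_lt_last a).ne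
    rw [hG]
    dsimp only
    rw [dif_neg ha4, Fin.castPred_castSucc]
  have hθ : ∀ i : Fin 5, MvPolynomial.aeval (fun j : Fin 5 => if j = i then (X i : MvPolynomial (Fin 5) k) else X j * X i) f = X i ^ 2 * G i := by
    intro i
    by_cases hi : i = 4
    · subst hi; rw [hG4]; exact X2CubicFormFrontEnd.theta_four k F hF f hf
    · have : i = Fin.castSucc (i.castPred hi) := (Fin.castSucc_castPred i hi).symm
      rw [this, hGw]
      exact X2CubicFormFrontEnd.theta_castSucc k F hF f hf _
  have hGX : ∀ i : Fin 5, G i ∉ Ideal.span {(X i : MvPolynomial (Fin 5) k)} := by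
    intro i
    by_cases hi : i = 4
    · subst hi; exact X2CubicFormTStep.G4_not_mem_span_X k _ (G 4) hG4
    · have : i = Fin.castSucc (i.castPred hi) := (Fin.castSucc_castPred i hi).symm
      rw [this]
      exact X2CubicFormTStep.G_not_mem_span_X k _ (Fin.castSucc_lt_last _).ne _ _ (hGw _)
  exact hypersurfacePointBlowup_fullCl p k 5 (by norm_num) f G 2 hfprime hθ (X2CubicFormFrontEnd.f_not_mem_span_X k F hF hF0 f hf) hGX
    (fun P _ hP => hoff P hP) (clause_every_chart k p G _ hGw hws _ hG4)

/-- ★★ **EVERY blowing up `S′` of `Spec 𝒪_{Y,v}` along the point floor is FULL at every stalk**, class level. [folklore transport; cite: GortzWedhorn2020, Prop. 13.91] -/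
theorem pointFloor_full (p : ℕ) [Fact p.Prime] [CharP k p] (F : MvPolynomial (Fin 4) k) (hF : F.IsHomogeneous 3) (f : MvPolynomial (Fin 5) k)
    (hf : f = X 4 ^ 2 + rename (Fin.castSucc : Fin 4 → Fin 5) F) (hprime : Prime f)
    (hoff : ∀ (P : Ideal (MvPolynomial (Fin 5) k ⧸ Ideal.span {f})) [P.IsPrime],
      ¬ Ideal.span (Set.range fun j : Fin 5 => Ideal.Quotient.mk (Ideal.span {f}) (X j)) ≤ P → IsRegularLocalRing (Localization.AtPrime P))
    (hw : ∀ a : Fin 4, Prime (MvPolynomial.aeval ((![![1, X 0, X 1, X 2], ![X 0, 1, X 1, X 2], ![X 0, X 1, 1, X 2], ![X 0, X 1, X 2, 1]] :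
      Fin 4 → Fin 4 → MvPolynomial (Fin 3) k) a) F))
    (hws : ∀ (a : Fin 4) (Q : Ideal (MvPolynomial (Fin 3) k)), Q.IsPrime →
      MvPolynomial.aeval ((![![1, X 0, X 1, X 2], ![X 0, 1, X 1, X 2], ![X 0, X 1, 1, X 2], ![X 0, X 1, X 2, 1]] : Fin 4 → Fin 4 → MvPolynomial (Fin 3) k) a) F ∈ Q →
      ∃ D : Derivation k (MvPolynomial (Fin 3) k) (MvPolynomial (Fin 3) k),
        D (MvPolynomial.aeval ((![![1, X 0, X 1, X 2], ![X 0, 1, X 1, X 2], ![X 0, X 1, 1, X 2], ![X 0, X 1, X 2, 1]] : Fin 4 → Fin 4 → MvPolynomial (Fin 3) k) a) F) ∉ Q)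
    (v : Spec (.of (MvPolynomial (Fin 5) k ⧸ Ideal.span {f})))
    (S' : Scheme.{0}) (g : S' ⟶ Spec ((Spec (.of (MvPolynomial (Fin 5) k ⧸ Ideal.span {f}))).presheaf.stalk v))
    (hg : IsBlowup g ((affineBlowup.idealSheaf (Ideal.span (Set.range (fun j : Fin 5 => Ideal.Quotient.mk (Ideal.span {f}) (X j))))).comap
      ((Spec (.of (MvPolynomial (Fin 5) k ⧸ Ideal.span {f}))).fromSpecStalk v))) :
    ∀ s : S', FullCl p (S'.presheaf.stalk s) := by
  haveI : Flat ((Spec (.of (MvPolynomial (Fin 5) k ⧸ Ideal.span {f}))).fromSpecStalk v) := flat_fromSpecStalk _ v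
  have hP := (affineBlowup.isBlowup (Ideal.span (Set.range (fun j : Fin 5 => Ideal.Quotient.mk (Ideal.span {f}) (X j))))).pullback_snd_of_flat
    ((Spec (.of (MvPolynomial (Fin 5) k ⧸ Ideal.span {f}))).fromSpecStalk v)
  obtain ⟨e, -, -⟩ := hg.unique hP
  intro s
  haveI := isIso_stalkMap_of_flat_of_isPreimmersion e.hom s
  refine FTemkinClosedPoints.fullCl_of_isIso_stalkMap' p e.hom s ?_
  haveI := isIso_stalkMap_pullback_fst_fromSpecStalk
    (affineBlowup.π (Ideal.span (Set.range (fun j : Fin 5 => Ideal.Quotient.mk (Ideal.span {f}) (X j))))) v (e.hom s)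
  exact FTemkinClosedPoints.fullCl_of_isIso_stalkMap' p
    (pullback.fst (affineBlowup.π (Ideal.span (Set.range (fun j : Fin 5 => Ideal.Quotient.mk (Ideal.span {f}) (X j))))) ((Spec (.of (MvPolynomial (Fin 5) k ⧸ Ideal.span {f}))).fromSpecStalk v))
    (e.hom s) (affineBlowup_fullCl k p F hF f hf hprime hoff hw hws _)

/-! ## §3 The complete class row -/

/-- ★★★ **THE T-SIDE CLASS ROW, COMPLETE.** For every field `k` of characteristic `p` (any prime), every cubic form `F ∈ k[Y₀..Y₃]` such that `f = X₄² + F` is PRIME, `Y = Spec k[X]/(f)` is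
regular off the vertex `v`, and the four dehomogenisations `F|_{Y_a=1}` are PRIME with SMOOTH zero locus (pointwise derivations):
(SCOPE) `v` closed ∧ `v ∉ Reg Y` ∧ `dim 𝒪_{Y,v} = 4`; (LEGAL-AND-FULL FLOOR) for EVERY blowing up `S′ → Spec 𝒪_{Y,v}` along `I = 𝔪̃·𝒪_{Y,v}`: `I ≠ ⊥` ∧ `Supp I ⊆ (Reg)ᶜ` ∧ `S′` regular
off the closed fibre ∧ `S′` FULL at every stalk; (INSTANCE) `TStepGerm.TStepInstanceAt p v I` — hence NON-VACUOUSLY: the point floor of every such double point is regularised by ONE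
blowing up along its reduced singular locus, the smooth irreducible cubic surface `{F = 0} ⊂ ℙ³ = E_red` (transversal type A₁). Vertex FULLness (T″'s outer hypothesis) is per bed.
[OURS · class-level certificate theorem with non-vacuity; cite: Fedder1983, Thm. 1.12; GortzWedhorn2020, Prop. 13.91 (2); Liu2002, Thm. 8.1.19 (a); StacksProject, Tag 07PF] -/
theorem tStep_row_of_doublePoint_cubicForm (p : ℕ) [Fact p.Prime] [CharP k p] (F : MvPolynomial (Fin 4) k) (hF : F.IsHomogeneous 3) (f : MvPolynomial (Fin 5) k)
    (hf : f = X 4 ^ 2 + rename (Fin.castSucc : Fin 4 → Fin 5) F) (hprime : Prime f)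
    (hoff : ∀ (P : Ideal (MvPolynomial (Fin 5) k ⧸ Ideal.span {f})) [P.IsPrime],
      ¬ Ideal.span (Set.range fun j : Fin 5 => Ideal.Quotient.mk (Ideal.span {f}) (X j)) ≤ P → IsRegularLocalRing (Localization.AtPrime P))
    (hw : ∀ a : Fin 4, Prime (MvPolynomial.aeval ((![![1, X 0, X 1, X 2], ![X 0, 1, X 1, X 2], ![X 0, X 1, 1, X 2], ![X 0, X 1, X 2, 1]] :
      Fin 4 → Fin 4 → MvPolynomial (Fin 3) k) a) F))
    (hws : ∀ (a : Fin 4) (Q : Ideal (MvPolynomial (Fin 3) k)), Q.IsPrime →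
      MvPolynomial.aeval ((![![1, X 0, X 1, X 2], ![X 0, 1, X 1, X 2], ![X 0, X 1, 1, X 2], ![X 0, X 1, X 2, 1]] : Fin 4 → Fin 4 → MvPolynomial (Fin 3) k) a) F ∈ Q →
      ∃ D : Derivation k (MvPolynomial (Fin 3) k) (MvPolynomial (Fin 3) k),
        D (MvPolynomial.aeval ((![![1, X 0, X 1, X 2], ![X 0, 1, X 1, X 2], ![X 0, X 1, 1, X 2], ![X 0, X 1, X 2, 1]] : Fin 4 → Fin 4 → MvPolynomial (Fin 3) k) a) F) ∉ Q)
    (v : Spec (.of (MvPolynomial (Fin 5) k ⧸ Ideal.span {f})))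
    (hv : v.asIdeal = Ideal.span (Set.range fun j : Fin 5 => Ideal.Quotient.mk (Ideal.span {f}) (X j))) :
    (IsClosed ({v} : Set (Spec (.of (MvPolynomial (Fin 5) k ⧸ Ideal.span {f})))) ∧
      v ∉ Scheme.regularLocus (Spec (.of (MvPolynomial (Fin 5) k ⧸ Ideal.span {f}))) ∧
      ringKrullDim ((Spec (.of (MvPolynomial (Fin 5) k ⧸ Ideal.span {f}))).presheaf.stalk v) = (4 : ℕ)) ∧
    (∀ (S' : Scheme.{0}) (g : S' ⟶ Spec ((Spec (.of (MvPolynomial (Fin 5) k ⧸ Ideal.span {f}))).presheaf.stalk v)),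
      IsBlowup g ((affineBlowup.idealSheaf (Ideal.span (Set.range (fun j : Fin 5 => Ideal.Quotient.mk (Ideal.span {f}) (X j))))).comap
        ((Spec (.of (MvPolynomial (Fin 5) k ⧸ Ideal.span {f}))).fromSpecStalk v)) →
      ((affineBlowup.idealSheaf (Ideal.span (Set.range (fun j : Fin 5 => Ideal.Quotient.mk (Ideal.span {f}) (X j))))).comap
          ((Spec (.of (MvPolynomial (Fin 5) k ⧸ Ideal.span {f}))).fromSpecStalk v)) ≠ ⊥ ∧
      (((((affineBlowup.idealSheaf (Ideal.span (Set.range (fun j : Fin 5 => Ideal.Quotient.mk (Ideal.span {f}) (X j))))).comap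
          ((Spec (.of (MvPolynomial (Fin 5) k ⧸ Ideal.span {f}))).fromSpecStalk v))).support :
            Set (Spec ((Spec (.of (MvPolynomial (Fin 5) k ⧸ Ideal.span {f}))).presheaf.stalk v))) ⊆
          (Scheme.regularLocus (Spec ((Spec (.of (MvPolynomial (Fin 5) k ⧸ Ideal.span {f}))).presheaf.stalk v)))ᶜ) ∧
      (∀ s : S', g.base s ≠ closedPoint ((Spec (.of (MvPolynomial (Fin 5) k ⧸ Ideal.span {f}))).presheaf.stalk v) → s ∈ Scheme.regularLocus S') ∧
      (∀ s : S', FullCl p (S'.presheaf.stalk s))) ∧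
    TStepGerm.TStepInstanceAt p v ((affineBlowup.idealSheaf (Ideal.span (Set.range fun j : Fin 5 => Ideal.Quotient.mk (Ideal.span {f}) (X j)))).comap
      ((Spec (.of (MvPolynomial (Fin 5) k ⧸ Ideal.span {f}))).fromSpecStalk v)) := by
  have hscope := X2CubicFormScope.vertex_scope k F hF f hf hprime v hv
  have hF0 : F ≠ 0 := by
    intro h0; have := (hw 0).ne_zero; rw [h0, map_zero] at this; exact this rfl
  -- legality of the point floor: `PointFloorLegalOfIsolated.pointFloor_input_legal` on the derived strict transforms
  have hreg : ∀ y : Spec (.of (MvPolynomial (Fin 5) k ⧸ Ideal.span {f})), y ⤳ v → y ≠ v →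
      y ∈ Scheme.regularLocus (Spec (.of (MvPolynomial (Fin 5) k ⧸ Ideal.span {f}))) := by
    intro y hy hne
    refine FermatCubicConeGerm.mem_regularLocus_Spec_of_isRegularLocalRing y (hoff y.asIdeal fun hle => hne ?_)
    have hyv : y.asIdeal ≤ v.asIdeal := (PrimeSpectrum.le_iff_specializes y v).mpr hy
    exact PrimeSpectrum.ext (le_antisymm hyv (hv ▸ hle))
  obtain ⟨G, hG⟩ : ∃ G : Fin 5 → MvPolynomial (Fin 5) k, G = fun i : Fin 5 =>
      if h : i = 4 then 1 + X 4 * rename (Fin.castSucc : Fin 4 → Fin 5) F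
      else X 4 ^ 2 + X i * rename ((![![1, 2, 3], ![0, 2, 3], ![0, 1, 3], ![0, 1, 2]] : Fin 4 → Fin 3 → Fin 5) (i.castPred h))
        (MvPolynomial.aeval ((![![1, X 0, X 1, X 2], ![X 0, 1, X 1, X 2], ![X 0, X 1, 1, X 2], ![X 0, X 1, X 2, 1]] :
          Fin 4 → Fin 4 → MvPolynomial (Fin 3) k) (i.castPred h)) F) := ⟨_, rfl⟩
  have hG4 : G 4 = 1 + X 4 * rename (Fin.castSucc : Fin 4 → Fin 5) F := by rw [hG]; simp
  have hGw : ∀ a : Fin 4, G (Fin.castSucc a) = X 4 ^ 2 + X (Fin.castSucc a) *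
      rename ((![![1, 2, 3], ![0, 2, 3], ![0, 1, 3], ![0, 1, 2]] : Fin 4 → Fin 3 → Fin 5) a)
        (MvPolynomial.aeval ((![![1, X 0, X 1, X 2], ![X 0, 1, X 1, X 2], ![X 0, X 1, 1, X 2], ![X 0, X 1, X 2, 1]] :
          Fin 4 → Fin 4 → MvPolynomial (Fin 3) k) a) F) := by
    intro a
    have ha4 : Fin.castSucc a ≠ (4 : Fin 5) := (Fin.castSucc_lt_last a).ne
    rw [hG]
    dsimp only
    rw [dif_neg ha4, Fin.castPred_castSucc]
  have hθ : ∀ i : Fin 5, MvPolynomial.aeval (fun j : Fin 5 => if j = i then (X i : MvPolynomial (Fin 5) k) else X j * X i) f =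
      X i ^ ((fun _ : Fin 5 => 2) i) * G i := by
    intro i
    dsimp only
    by_cases hi : i = 4
    · subst hi; rw [hG4]; exact X2CubicFormFrontEnd.theta_four k F hF f hf
    · have : i = Fin.castSucc (i.castPred hi) := (Fin.castSucc_castPred i hi).symm
      rw [this, hGw]
      exact X2CubicFormFrontEnd.theta_castSucc k F hF f hf _
  have hGX : ∀ i : Fin 5, G i ∉ Ideal.span {(X i : MvPolynomial (Fin 5) k)} := by
    intro i
    by_cases hi : i = 4
    · subst hi; exact X2CubicFormTStep.G4_not_mem_span_X k _ (G 4) hG4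
    · have : i = Fin.castSucc (i.castPred hi) := (Fin.castSucc_castPred i hi).symm
      rw [this]
      exact X2CubicFormTStep.G_not_mem_span_X k _ (Fin.castSucc_lt_last _).ne _ _ (hGw _)
  refine ⟨hscope, fun S' g hg => ?_, X2CubicFormFrontEnd.tStepInstanceAt_of_doublePoint_cubicForm k p F hF f hf hprime hoff hw hws v hv⟩
  obtain ⟨h1, h2, h3, -⟩ := PointFloorLegalOfIsolated.pointFloor_input_legal k f hprime (by norm_num) (fun _ : Fin 5 => 2) G hθ
    (X2CubicFormFrontEnd.f_not_mem_span_X k F hF hF0 f hf) hGX v hv hscope.2.1 hreg S' g hg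
  exact ⟨h1, h2, h3, pointFloor_full k p F hF f hf hprime hoff hw hws v S' g hg⟩

end Summit.ResolutionOfSingularities.ResolutionOfSingularities.Theorems.FInjectiveMacaulayfication.X2CubicFormTStepRow

end
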